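import Mathlib
import Summits.KontsevichZagierPeriods.Zeta5Search.Certificates.RecordRayRaySteps
import Summits.KontsevichZagierPeriods.Zeta5Search.Certificates.RayC1GenericSteps
import HarnessLib

/-!
# The closed-form steps at affine points of the calibration ray C1 (fam-tele g17, S4-C1 LITE file L2)

HONEST FRAMING: systematic search; no irrationality claim unless certified.  Exact algebra about the coefficient frame
`T(b)` (`RecordRayConnection.frameMat`) at the affine points `c1Pt β n = n·(85;35,32,30,27,25,22,20) + β` of the C1 ray;
nothing here evaluates a linear form, `ζ(5)` or a denominator.  This is the C1 copy of the ray-specific half of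
`RecordRayRaySteps` (§§2–4 there): the Boolean side-condition checkers `ptChk` (box, `d ≥ 3`, `b₇ + 3 ≤ b₀`, slot order —
now with the C1 slopes `b₀ = 85n + β₀`, `b₇ = 20n + β₇`, `d = 64n + (3β₀ − Σβ_j)`), `pairChk`, `prChk`, the link checkers
`lowerChk/dsChk/hChk`, their soundness for every `n ≥ 1`, and the four step identities RAISE/DS/H at a checked affine point
(`lower_step`, `ds_step`, `h_step`) with the non-vanishing of their scalars (`gamma3_ne`, `hScale_det_ne`) and of `det T`
(`frameMat_det_ne`).  Everything generic — the `castPt` lemmas, `frameMat_congr`, `affOK`, `bsum7`, `bumpTgt/dsTgt/hTgt`,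
`topGamma3_ne_of_le`, the step theorems of `RecordRayConnection` — is imported BY NAME from the record files; decl names are
kept identical to the record's inside the namespace `…RayC1.Generic` (cert-1 g7's request, for the mechanical port of (E)).
-/

namespace Summit.KontsevichZagierPeriods.Zeta5Search.RayC1.Generic

open Finset Matrix
open Summit.KontsevichZagierPeriods.Zeta5Search.DualSeries (InBox)
open Summit.KontsevichZagierPeriods.Zeta5Search.WedgeDictionary
open Summit.KontsevichZagierPeriods.Zeta5Search.Elimination
open Summit.KontsevichZagierPeriods.Zeta5Search.DualSeriesLemma19 (coeffV_congr')
open Summit.KontsevichZagierPeriods.Zeta5Search.RecordRay.Connection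
open Summit.KontsevichZagierPeriods.Zeta5Search.RecordRay.Generic (affOK affOK_sound bsum7 bumpTgt dsMatG dsMatG_castPt dsTgt frameMat_congr hMatG_castPt hScaleG hScaleG_castPt
  hTgt hTildeG lowerMatG raise7MatG_castPt raiseMatG_castPt topGamma3G topGamma3G_castPt topGamma3_ne_of_le)

/-! ### 1. Affine side conditions on the C1 ray, checked once for all `n ≥ 1` -/

/-- The point check: `b₀ ≥ 1`, `d ≥ 3`, `b₇ + 3 ≤ b₀`, `0 ≤ b_j ≤ b₀` (`j = 1..7`) at `c1Pt β n` for all `n ≥ 1`. -/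
def ptChk (β : List ℤ) : Bool :=
  affOK 85 (β.getD 0 0 - 1) && affOK 64 (3 * β.getD 0 0 - bsum7 β - 3) && affOK 65 (β.getD 0 0 - β.getD 7 0 - 3) &&
    (List.range 7).all fun j =>
      affOK (c1Dir.getD (j + 1) 0) (β.getD (j + 1) 0) &&
        affOK (85 - c1Dir.getD (j + 1) 0) (β.getD 0 0 - β.getD (j + 1) 0)

/-- Slot `0` of the C1 point. -/
theorem c1Pt_zero (β : List ℤ) (n : ℕ) : c1Pt β n 0 = 85 * n + β.getD 0 0 := by simp [c1Pt, c1Dir]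

/-- Slot `7` of the C1 point. -/
theorem c1Pt_seven (β : List ℤ) (n : ℕ) : c1Pt β n 7 = 20 * n + β.getD 7 0 := by simp [c1Pt, c1Dir]

/-- The interior slots of the C1 point. -/
theorem c1Pt_succ (β : List ℤ) (n j : ℕ) : c1Pt β n (j + 1) = c1Dir.getD (j + 1) 0 * n + β.getD (j + 1) 0 :=
  rfl

/-- `d` of the C1 point. -/
theorem dOf_c1Pt (β : List ℤ) (n : ℕ) : dOf (c1Pt β n) = 64 * n + (3 * β.getD 0 0 - bsum7 β) := by
  simp [dOf, c1Pt, c1Dir, bsum7, sum_range_succ]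
  ring

/-- The side conditions every step lemma needs, at `c1Pt β n` for every `n ≥ 1`: box, `d ≥ 3`, slot order,
`b₇ + 3 ≤ b₀`, `b₀ ≥ 1`. -/
theorem ptChk_sound {β : List ℤ} (h : ptChk β = true) {n : ℕ} (hn : 1 ≤ n) :
    InBox (c1Pt β n) ∧ 3 ≤ dOf (c1Pt β n) ∧ (∀ i, i < 7 → c1Pt β n (i + 1) ≤ c1Pt β n 0) ∧
      c1Pt β n 7 + 3 ≤ c1Pt β n 0 ∧ 1 ≤ (c1Pt β n 0).toNat := by
  simp only [ptChk, Bool.and_eq_true, List.all_eq_true, List.mem_range] at h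
  obtain ⟨⟨⟨h0, hd⟩, h7⟩, hall⟩ := h
  have e0 := c1Pt_zero β n
  have e7 := c1Pt_seven β n
  have A0 := affOK_sound h0 hn
  have Ad := affOK_sound hd hn
  have A7 := affOK_sound h7 hn
  have AS : ∀ j, j < 7 → 0 ≤ c1Dir.getD (j + 1) 0 * (n : ℤ) + β.getD (j + 1) 0 ∧
      0 ≤ (85 - c1Dir.getD (j + 1) 0) * (n : ℤ) + (β.getD 0 0 - β.getD (j + 1) 0) :=
    fun j hj => ⟨affOK_sound (hall j hj).1 hn, affOK_sound (hall j hj).2 hn⟩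
  unfold InBox
  refine ⟨⟨by rw [e0]; linarith, fun j hj => ?_⟩, ?_, fun i hi => ?_, ?_, ?_⟩
  · obtain ⟨a1, a2⟩ := AS j (mem_range.1 hj)
    rw [c1Pt_succ, e0]
    constructor <;> linarith
  · rw [dOf_c1Pt]; linarith
  · obtain ⟨_, a2⟩ := AS i hi
    rw [c1Pt_succ, e0]; linarith
  · rw [e7, e0]; linarith
  · rw [e0]; omega

/-- Pair sums `b_j + b_k ≤ b₀` (for `cas3_ne_zero`). -/
def pairChk (β : List ℤ) : Bool :=
  allPairs.all fun jk =>
    affOK (85 - c1Dir.getD jk.1 0 - c1Dir.getD jk.2 0) (β.getD 0 0 - β.getD jk.1 0 - β.getD jk.2 0)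

/-- Soundness of the pair checker: a passed check gives the slot inequalities it encodes. -/
theorem pairChk_sound {β : List ℤ} (h : pairChk β = true) {n : ℕ} (hn : 1 ≤ n) :
    ∀ jk ∈ allPairs, c1Pt β n jk.1 + c1Pt β n jk.2 ≤ c1Pt β n 0 := by
  intro jk hjk
  have A := affOK_sound (List.all_eq_true.1 h jk hjk) hn
  have e1 : c1Pt β n jk.1 = c1Dir.getD jk.1 0 * n + β.getD jk.1 0 := rfl
  have e2 : c1Pt β n jk.2 = c1Dir.getD jk.2 0 * n + β.getD jk.2 0 := rfl
  rw [e1, e2, c1Pt_zero]; linarith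

/-- The six factors of `raisePr` are positive: `b_j + b_k ≤ b₀` for `j < k` in `{1,2,3,6}`. -/
def prChk (β : List ℤ) : Bool :=
  [(1, 2), (1, 3), (1, 6), (2, 3), (2, 6), (3, 6)].all fun jk : ℕ × ℕ =>
    affOK (85 - c1Dir.getD jk.1 0 - c1Dir.getD jk.2 0) (β.getD 0 0 - β.getD jk.1 0 - β.getD jk.2 0)

/-- The factorial-type factors met along the ray are positive. -/
private theorem fac_pos {b : ℕ → ℤ} {j k : ℕ} (h : b j + b k ≤ b 0) : (0 : ℚ) < (b 0 : ℚ) + 1 - b j - b k := by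
  have : ((b j + b k : ℤ) : ℚ) ≤ (b 0 : ℚ) := by exact_mod_cast h
  push_cast at this; linarith

/-- The raising prefactor does not vanish at a checked point. -/
theorem raisePr_ne {β : List ℤ} (h : prChk β = true) {n : ℕ} (hn : 1 ≤ n) : raisePr (c1Pt β n) ≠ 0 := by
  have A : ∀ jk ∈ [((1 : ℕ), (2 : ℕ)), (1, 3), (1, 6), (2, 3), (2, 6), (3, 6)],
      c1Pt β n jk.1 + c1Pt β n jk.2 ≤ c1Pt β n 0 := by
    intro jk hjk
    have a := affOK_sound (List.all_eq_true.1 h jk hjk) hn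
    have e1 : c1Pt β n jk.1 = c1Dir.getD jk.1 0 * n + β.getD jk.1 0 := rfl
    have e2 : c1Pt β n jk.2 = c1Dir.getD jk.2 0 * n + β.getD jk.2 0 := rfl
    rw [e1, e2, c1Pt_zero]; linarith
  have f12 := fac_pos (A (1, 2) (by simp))
  have f13 := fac_pos (A (1, 3) (by simp))
  have f16 := fac_pos (A (1, 6) (by simp))
  have f23 := fac_pos (A (2, 3) (by simp))
  have f26 := fac_pos (A (2, 6) (by simp))
  have f36 := fac_pos (A (3, 6) (by simp))
  unfold raisePr
  exact mul_ne_zero (mul_ne_zero (mul_ne_zero (mul_ne_zero (mul_ne_zero f12.ne' f13.ne') f16.ne') f23.ne')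
    f26.ne') f36.ne'

/-! ### 3. The next point, slotwise -/

/-- At a checked integer point the generic raising matrix specialises to the tree's raising step. -/
theorem bump_agree {β β' : List ℤ} {i : ℕ} (h : bumpTgt β β' i = true) (n : ℕ) :
    ∀ j, j ≤ 7 → bump (c1Pt β n) i j = c1Pt β' n j := by
  intro j hj
  have e := List.all_eq_true.1 h j (List.mem_range.2 (by omega))
  simp only [decide_eq_true_eq] at e
  by_cases hji : j = i + 1
  · subst hji
    simp only [bump, Function.update_self, c1Pt, e, if_true]; ring
  · rw [bump, Function.update_of_ne hji]
    simp only [c1Pt, e, hji, if_false]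

/-- At a checked integer point the generic diagonal-shift matrix specialises to the tree's DS step. -/
theorem ds_agree {β β' : List ℤ} (h : dsTgt β β' = true) (n : ℕ) :
    ∀ j, j ≤ 7 → dsShift (c1Pt β n) j = c1Pt β' n j := by
  intro j hj
  have e := List.all_eq_true.1 h j (List.mem_range.2 (by omega))
  simp only [decide_eq_true_eq] at e
  by_cases hj0 : j = 0
  · subst hj0; simp only [dsShift, c1Pt, e, if_true]; ring
  · simp only [dsShift, c1Pt, e, hj0, if_false]; ring

/-- At a checked integer point the generic `H` matrix specialises to the tree's `H` step. -/
theorem h_agree {β β' : List ℤ} (h : hTgt β β' = true) (n : ℕ) :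
    ∀ j, j ≤ 7 → hShift (c1Pt β n) j = c1Pt β' n j := by
  intro j hj
  have e := List.all_eq_true.1 h j (List.mem_range.2 (by omega))
  simp only [decide_eq_true_eq] at e
  by_cases hj0 : j = 0 ∨ j = 4 ∨ j = 5 ∨ j = 7
  · simp only [hShift, c1Pt, e, hj0, if_true]; ring
  · simp only [hShift, c1Pt, e, hj0, if_false]

/-! ### 4. The steps at affine points, for every `n ≥ 1` -/

/-- RAISE in lattice slot `i+1 ≤ 7`: point check, slot, and target. -/
def lowerChk (β β' : List ℤ) (i : ℕ) : Bool := ptChk β && decide (i ≤ 6) && bumpTgt β β' i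
/-- DS: point check and target. -/
def dsChk (β β' : List ℤ) : Bool := ptChk β && dsTgt β β'
/-- H: point check, `pr ≠ 0`, and target. -/
def hChk (β β' : List ℤ) : Bool := ptChk β && prChk β && hTgt β β'

/-- A passed lowering check contains the point check. -/
theorem ptChk_of_lowerChk {β β' : List ℤ} {i : ℕ} (h : lowerChk β β' i = true) : ptChk β = true := by
  simp only [lowerChk, Bool.and_eq_true] at h; exact h.1.1

/-- A passed DS check contains the point check. -/
theorem ptChk_of_dsChk {β β' : List ℤ} (h : dsChk β β' = true) : ptChk β = true := by
  simp only [dsChk, Bool.and_eq_true] at h; exact h.1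

/-- A passed `H` check contains the point check. -/
theorem ptChk_of_hChk {β β' : List ℤ} (h : hChk β β' = true) : ptChk β = true := by
  simp only [hChk, Bool.and_eq_true] at h; exact h.1.1

/-- A passed `H` check contains the prefactor check. -/
theorem prChk_of_hChk {β β' : List ℤ} (h : hChk β β' = true) : prChk β = true := by
  simp only [hChk, Bool.and_eq_true] at h; exact h.1.2

/-- **RAISE at an affine point.** `R̃_{i+1}(p)·T(p) = γ₃(p)·T(p + e_{i+1})`, `p = c1Pt β n`, all `n ≥ 1`. -/
theorem lower_step {β β' : List ℤ} {i : ℕ} (h : lowerChk β β' i = true) {n : ℕ} (hn : 1 ≤ n) :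
    lowerMatG (c1PtG β (n : ℚ)) i * frameMat (c1Pt β n) =
      topGamma3G (c1PtG β (n : ℚ)) • frameMat (c1Pt β' n) := by
  simp only [lowerChk, Bool.and_eq_true, decide_eq_true_eq] at h
  obtain ⟨⟨hp, hi⟩, ht⟩ := h
  obtain ⟨Pbox, Pd, Pslot, P7, P1⟩ := ptChk_sound hp hn
  rw [← castPt_c1Pt, topGamma3G_castPt, ← frameMat_congr (bump_agree ht n)]
  unfold lowerMatG
  split_ifs with h6
  · subst h6
    rw [raise7MatG_castPt]
    exact raise7Mat_mul_frameMat _ Pbox (by linarith) (by linarith)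
  · rw [raiseMatG_castPt]
    exact raiseMat_mul_frameMat _ Pbox (by linarith) (mem_range.2 (by omega)) (Pslot i (by omega)) (by linarith) P1

/-- **DS at an affine point.** `D̃S(p)·T(p) = γ₃(p)·T(p⁺)`. -/
theorem ds_step {β β' : List ℤ} (h : dsChk β β' = true) {n : ℕ} (hn : 1 ≤ n) :
    dsMatG (c1PtG β (n : ℚ)) * frameMat (c1Pt β n) = topGamma3G (c1PtG β (n : ℚ)) • frameMat (c1Pt β' n) := by
  simp only [dsChk, Bool.and_eq_true] at h
  obtain ⟨hp, ht⟩ := h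
  obtain ⟨Pbox, Pd, -, P7, -⟩ := ptChk_sound hp hn
  rw [← castPt_c1Pt, topGamma3G_castPt, dsMatG_castPt, ← frameMat_congr (ds_agree ht n)]
  exact dsMat_mul_frameMat _ Pbox (by linarith) (by linarith)

/-- **H at an affine point.** `H̃(z)·T(z) = det(hScale z)·T(Hz)` with `H̃ = adj(hScale)·hMat`. -/
theorem h_step {β β' : List ℤ} (h : hChk β β' = true) {n : ℕ} (hn : 1 ≤ n) :
    hTildeG (c1PtG β (n : ℚ)) * frameMat (c1Pt β n) =
      (hScaleG (c1PtG β (n : ℚ))).det • frameMat (c1Pt β' n) := by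
  have hp := ptChk_of_hChk h
  simp only [hChk, Bool.and_eq_true] at h
  obtain ⟨_, ht⟩ := h
  obtain ⟨Pbox, Pd, -, P7, -⟩ := ptChk_sound hp hn
  rw [← castPt_c1Pt, hTildeG, hScaleG_castPt, hMatG_castPt, ← frameMat_congr (h_agree ht n), Matrix.mul_assoc,
    hMat_mul_frameMat _ Pbox Pd P7, ← Matrix.mul_assoc, Matrix.adjugate_mul, smul_mul_assoc, Matrix.one_mul]

/-! ### 5. Non-vanishing of the step scalars and of `det T` at checked points -/

/-- `topGamma3` does not vanish at a checked point. -/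
theorem gamma3_ne {β : List ℤ} (hp : ptChk β = true) {n : ℕ} (hn : 1 ≤ n) : topGamma3G (c1PtG β (n : ℚ)) ≠ 0 := by
  rw [← castPt_c1Pt, topGamma3G_castPt]
  exact topGamma3_ne_of_le (ptChk_sound hp hn).2.1

/-- The `H`-scaling matrix is invertible at a checked point. -/
theorem hScale_det_ne {β : List ℤ} (hp : ptChk β = true) (hq : prChk β = true) {n : ℕ} (hn : 1 ≤ n) :
    (hScaleG (c1PtG β (n : ℚ))).det ≠ 0 := by
  rw [← castPt_c1Pt, hScaleG_castPt]
  have Pd := (ptChk_sound hp hn).2.1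
  have hpr : raisePr (c1Pt β n) ≠ 0 := raisePr_ne hq hn
  have hpr1 : raisePr (bump (c1Pt β n) 6) = raisePr (c1Pt β n) := by simp [raisePr, bump]
  have hpr2 : raisePr (bump (bump (c1Pt β n) 6) 6) = raisePr (c1Pt β n) := by simp [raisePr, bump]
  have hg0 : topGamma3 (c1Pt β n) ≠ 0 := topGamma3_ne_of_le Pd
  have hg1 : topGamma3 (bump (c1Pt β n) 6) ≠ 0 := by
    rw [topGamma3_eq, dOf_bump _ (mem_range.2 (by norm_num))]
    have : (3 : ℚ) ≤ (dOf (c1Pt β n) : ℚ) := by exact_mod_cast Pd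
    push_cast; intro h0; linarith
  rw [Matrix.det_fin_three]
  simp [hScale, hpr1, hpr2, hpr, hg0, hg1]

/-- The coefficient frame is invertible at a checked point. -/
theorem frameMat_det_ne {β : List ℤ} (hp : ptChk β = true) (hpair : pairChk β = true) {n : ℕ} (hn : 1 ≤ n) :
    (frameMat (c1Pt β n)).det ≠ 0 := by
  rw [frameMat_det]
  obtain ⟨Pbox, Pd, -, P7, -⟩ := ptChk_sound hp hn
  exact cas3_ne_zero _ Pbox (by linarith) (by linarith) (pairChk_sound hpair hn)

end Summit.KontsevichZagierPeriods.Zeta5Search.RayC1.Generic
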